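import Mathlib
import Literature.NumberTheory.Automorphic.TwistedQuotientGrowthTransfer
import Literature.NumberTheory.Automorphic.TwistedQuotientGrowthAverage
import Literature.NumberTheory.Automorphic.ResGLnConeEntryGaugeBounds
import Literature.NumberTheory.Automorphic.ResGLnConeDictionaryCone
import Summits.Langlands.Langlands.Theorems.IrreducibilityBySelfDualityHeckeEigenvalueFieldStubRadial
import Summits.Langlands.Langlands.Theorems.IrreducibilityBySelfDualityHeckeEigenvalueFieldStubConeBasic
import Summits.Langlands.Langlands.Theorems.IrreducibilityBySelfDualityHeckeEigenvalueFieldStubDetUnit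
import Summits.Langlands.Langlands.Theorems.IrreducibilityBySelfDualityHeckeEigenvalueFieldStubAverage
import Summits.Langlands.Langlands.Theorems.IrreducibilityBySelfDualityHeckeEigenvalueFieldStubEquivFull
import Summits.Langlands.Langlands.Theorems.IrreducibilityBySelfDualityHeckeEigenvalueFieldStubReducedCover
import HarnessLib

/-!
# Basic-ising and averaging the per-coset primitive — crux HeckeEigenvalueField
# (stmt-Langlands-13632), line Sketch, stub `stub_fam_ba` (FAM-BA)

Namespace `Summit.Langlands.Langlands.Theorems.HeckeEigenvalueField.Res` (the construction in
`…Res.FamBA.main`); theorems only.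

On a level coset `cL` we are given a smooth `q`-form `β₀` on the positive cone `X = posCone n K`,
invariant (twisted pull-back `actAlt`) under a subgroup `Γ_c ≤ GL_n(K)⁺` of the stabiliser of `cL`
whose translates of finitely many reduced sets `t · R(p₀)`, `t ∈ T`, cover `X`, with `dβ₀ = ω_c`
(the cone form of a basic `(𝔤, K_∞)`-cocycle `η`) and polynomial `C¹` bounds on
`F' = ⋃_{t ∈ T} t · R(p₀)` in the entry gauge `E(H) = 1 + ∑ (‖H i j‖ + ‖H⁻¹ i j‖)`.  Output: `β₂`,
smooth, equivariant under the FULL rational stabiliser `G` of `cL`, basic, with `dβ₂ = ω_c` and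
polynomial `C¹` bounds on every rational translate `δ · R(p₁)` of every reduced set.
Construction: `β₁ = p^* β₀` for the radial projection `p` (landed RADIAL; `p` commutes with `G` by
DET-UNIT; `dβ₁ = ω_c` as `ω_c` is basic, BASIC), and `β₂` the average of the twisted pull-backs of
`β₁` over `G ⧸ φ(Γ_c)` (AVG; `ω_c` is `G`-invariant by EQUIV-FULL and the level invariance `hω`;
`φ(Γ_c)` has finite index by the cover, COVER-FIN (ii) and the sign characters of `det`).  The
growth is the abstract transfer of `Literature/…/TwistedQuotientGrowthTransfer{,Average}`, fed
with COVER-FIN (ii) and the gauge estimates of `Literature/…/ResGLnConeEntryGaugeBounds`.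

References: [Borel1983Regularization, §3.5]; [BorelWallach2000, VII 2.2–2.7]; [Borel1969, §13, §15].
-/

set_option linter.dupNamespace false -- project-wide: `Summit.Langlands.Langlands` is the mandated namespace

noncomputable section

open scoped Matrix.Norms.Operator Topology Classical Matrix TensorProduct
open Filter Set NumberField NumberField.mixedEmbedding Literature.NumberTheory.Automorphic
  Literature.NumberTheory.Automorphic.TwistedQuotient Literature.NumberTheory.DiophantineGeometry

attribute [-instance] instTopologicalSpaceMatrix
attribute [-instance] Matrix.instUniformSpace
attribute [local instance high] NormedAddCommGroup.toSeminormedAddCommGroup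

namespace Summit.Langlands.Langlands.Theorems.HeckeEigenvalueField.Res

open ResGLnCohomology BigHeckeGLn ResGLnCone ConeDictionary SiegelFamily

namespace FamBA

variable {n : ℕ} {K : Type} [Field K] [NumberField K]

set_option maxHeartbeats 800000 in
/-- **FAM-BA, the construction** (see `stub_fam_ba` for the mathematics): `β₂` is the average over
`G ⧸ φ(Γ_c)` of the twisted pull-backs of the radial pull-back `p^* β₀`.
[cite: Borel1983Regularization, §3.5] [cite: BorelWallach2000, VII 2.2–2.7] -/
theorem main (hn : 0 < n) (hcpt : isCompact_glFiniteIntegralLevel n K) (𝔫 : Ideal (𝓞 K))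
    (π : CuspidalAutomorphicRepData n K hcpt) (S : Finset {w : InfinitePlace K // w.IsReal})
    (lam : (K →+* ℂ) → Fin n → ℤ) {q : ℕ} {η : Cochain π.1 lam (q + 1)}
    (hη : η ∈ (gkComplexLS π.1 S lam).cocycles (q + 1))
    (hZ : Literature.Algebra.Lie.ChevalleyEilenberg.ins q (⟨1, trivial⟩ : (AutomorphyDatum.gl n K hcpt).arch.lie) η = 0)
    (hω : TwistedQuotient.IsConeFormFamily (diagPos n K) (level n K 𝔫) (coeffRepPos ℂ n K lam)
      ((coneActionRat n K).comp (glTotPos n K).subtype) (posCone n K) (fun c H => coneForm π.1 S lam η c H))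
    (cL : FiniteAdelicGL n K ⧸ level n K 𝔫) (Γc : Subgroup (glTotPos n K))
    (hΓc : ∀ γ : Γc, diagPos n K (γ : glTotPos n K) • cL = cL) (T : Finset (GL (Fin n) K)) (c₀ C₀ τ₀ : ℝ)
    (hcov : ∀ H ∈ posCone n K, ∃ (γ : Γc) (t : GL (Fin n) K), t ∈ T ∧ IsReduced c₀ C₀ τ₀ n (placeFamily K
      ((coneActionRat n K (((γ : glTotPos n K) : GL (Fin n) K) * t)⁻¹ H : hermSpace n K) : Matrix (Fin n) (Fin n) (mixedSpace K))))
    (β₀ : hermSpace n K → (hermSpace n K [⋀^Fin q]→L[ℝ] CoeffModule ℂ n K lam))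
    (hβ₀s : ContDiffOn ℝ ((⊤ : ℕ∞) : WithTop ℕ∞) β₀ (posCone n K))
    (hβ₀i : ∀ (γ : Γc), ∀ x ∈ posCone n K, TwistedQuotient.actAlt ((coeffRepPos ℂ n K lam).comp Γc.subtype)
      (((coneActionRat n K).comp (glTotPos n K).subtype).comp Γc.subtype) γ q
      (β₀ ((((coneActionRat n K).comp (glTotPos n K).subtype).comp Γc.subtype) γ⁻¹ x)) = β₀ x)
    (hβ₀d : ∀ x ∈ posCone n K, extDeriv β₀ x = @id (hermSpace n K [⋀^Fin (q + 1)]→L[ℝ] CoeffModule ℂ n K lam) (coneForm π.1 S lam η cL.out x))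
    (hβ₀b : ∃ (C : ℝ) (k : ℕ), ∀ x ∈ {H : hermSpace n K | H ∈ posCone n K ∧ ∃ t ∈ T, IsReduced c₀ C₀ τ₀ n (placeFamily K
        ((coneActionRat n K t⁻¹ H : hermSpace n K) : Matrix (Fin n) (Fin n) (mixedSpace K)))},
      ‖β₀ x‖ ≤ C * (1 + ∑ i, ∑ j, (‖(x : Matrix (Fin n) (Fin n) (mixedSpace K)) i j‖ + ‖(x : Matrix (Fin n) (Fin n) (mixedSpace K))⁻¹ i j‖)) ^ k ∧
      ‖fderiv ℝ β₀ x‖ ≤ C * (1 + ∑ i, ∑ j, (‖(x : Matrix (Fin n) (Fin n) (mixedSpace K)) i j‖ + ‖(x : Matrix (Fin n) (Fin n) (mixedSpace K))⁻¹ i j‖)) ^ k) :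
    ∃ β₂ : hermSpace n K → (hermSpace n K [⋀^Fin q]→L[ℝ] CoeffModule ℂ n K lam),
      ContDiffOn ℝ ((⊤ : ℕ∞) : WithTop ℕ∞) β₂ (posCone n K) ∧
      (∀ (γ : GL (Fin n) K), globalEmbedding n K γ • cL = cL → ∀ x ∈ posCone n K, ∀ v : Fin q → hermSpace n K,
        β₂ (coneActionRat n K γ x) (fun i => coneActionRat n K γ (v i)) = σS hcpt S lam (ParallelWeight.diagArch K n γ) (β₂ x v)) ∧
      (∀ (r : ℝ), 0 < r → ∀ x ∈ posCone n K, ∀ v : Fin q → hermSpace n K, β₂ (r • x) (fun i => r • v i) = β₂ x v) ∧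
      (∀ x ∈ posCone n K, ∀ v : Fin q → hermSpace n K, (∃ i, v i = x) → β₂ x v = 0) ∧
      (∀ x ∈ posCone n K, extDeriv β₂ x = @id (hermSpace n K [⋀^Fin (q + 1)]→L[ℝ] CoeffModule ℂ n K lam) (coneForm π.1 S lam η cL.out x)) ∧
      ∀ (δ : GL (Fin n) K) (c₁ C₁ τ₁ : ℝ), ∃ (C : ℝ) (k : ℕ), ∀ x ∈ posCone n K,
        IsReduced c₁ C₁ τ₁ n (placeFamily K ((coneActionRat n K δ⁻¹ x : hermSpace n K) : Matrix (Fin n) (Fin n) (mixedSpace K))) →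
        ∀ (v : Fin q → hermSpace n K) (w' : hermSpace n K),
          ‖β₂ x v‖ ≤ C * (1 + ∑ i, ∑ j, (‖(x : Matrix (Fin n) (Fin n) (mixedSpace K)) i j‖ + ‖(x : Matrix (Fin n) (Fin n) (mixedSpace K))⁻¹ i j‖)) ^ k * ∏ i, ‖v i‖ ∧
          ‖fderiv ℝ β₂ x w' v‖ ≤ C * (1 + ∑ i, ∑ j, (‖(x : Matrix (Fin n) (Fin n) (mixedSpace K)) i j‖ + ‖(x : Matrix (Fin n) (Fin n) (mixedSpace K))⁻¹ i j‖)) ^ k * ‖w'‖ * ∏ i, ‖v i‖ := by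
  classical
  have hη' : η ∈ (gkComplexLS π.1 S lam).carrier (q + 1) := (((gkComplexLS π.1 S lam).mem_cocycles_iff (q + 1) η).1 hη).1
  have hXo : IsOpen (posCone n K) := isOpen_posCone n K
  have hXm : ∀ g : GL (Fin n) K, MapsTo (coneActionRat n K g) (posCone n K) (posCone n K) := mapsTo_coneActionRat_posCone n K
  /- RADIAL and BASIC -/
  obtain ⟨N, hN⟩ : ∃ N : hermSpace n K → ℝ, ∀ H, N H = mixedEmbedding.norm (Matrix.det (H : Matrix (Fin n) (Fin n) (mixedSpace K))) :=
    ⟨_, fun _ => rfl⟩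
  have hd1 : (1 : ℝ) ≤ (n : ℝ) * (Module.finrank ℚ K : ℝ) :=
    one_le_mul_of_one_le_of_one_le (by exact_mod_cast hn) (by exact_mod_cast Module.finrank_pos)
  have he0 : (0 : ℝ) < 1 / ((n : ℝ) * (Module.finrank ℚ K : ℝ)) := by positivity
  have he1 : 1 / ((n : ℝ) * (Module.finrank ℚ K : ℝ)) ≤ 1 := (div_le_one (by positivity)).2 hd1
  obtain ⟨p, hp⟩ : ∃ p : hermSpace n K → hermSpace n K, ∀ H, p H = (N H) ^ (-(1 / ((n : ℝ) * (Module.finrank ℚ K : ℝ)))) • H :=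
    ⟨_, fun _ => rfl⟩
  obtain ⟨hNpos, -, hpX, hpscale, hpsmooth, hpequiv, ⟨Cp, kp, hpbd⟩, hpbasic⟩ :=
    stub_radialProjection n K hn N hN (1 / ((n : ℝ) * (Module.finrank ℚ K : ℝ))) rfl p hp
  have hpX' : ∀ x ∈ posCone n K, p x ∈ posCone n K := fun x hx => (hpX x hx).1
  have hpdiff : DifferentiableOn ℝ p (posCone n K) := hpsmooth.differentiableOn (by simp)
  have hp2 : ContDiffOn ℝ ((⊤ : ℕ∞) : WithTop ℕ∞) (fun x => fderiv ℝ p x) (posCone n K) :=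
    ((contDiffOn_infty_iff_fderiv_of_isOpen hXo).1 hpsmooth).2
  obtain ⟨hEu, hsc⟩ := stub_coneForm_basic π.1 S lam hη hZ cL.out
  /- the rational stabiliser `G`, the image `Hs = φ(Γ_c)` of finite index, the actions -/
  obtain ⟨G, hG⟩ : ∃ G : Subgroup (GL (Fin n) K), G = (MulAction.stabilizer (FiniteAdelicGL n K) cL).comap (globalEmbedding n K) :=
    ⟨_, rfl⟩
  have hmemG : ∀ γ : GL (Fin n) K, γ ∈ G ↔ globalEmbedding n K γ • cL = cL := fun γ => by
    rw [hG, Subgroup.mem_comap, MulAction.mem_stabilizer_iff]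
  let φ : Γc →* G := ((glTotPos n K).subtype.comp Γc.subtype).codRestrict G fun γ => (hmemG _).2 (hΓc γ)
  obtain ⟨Hs, hHs⟩ : ∃ Hs : Subgroup G, Hs = φ.range := ⟨_, rfl⟩
  haveI : ((glTotPos n K).subgroupOf G).FiniteIndex := ResGLnCohomology.finiteIndex_subgroupOf_glTotPos G
  haveI hfi : Hs.FiniteIndex := by
    rw [hHs]
    refine finiteIndex_range_of_cover (coneActionRat n K) hXm ⟨_, hermOne_mem_posCone n K⟩ G (glTotPos n K) φ
      (fun γ => (γ : glTotPos n K).2) T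
      (R₀ := {H : hermSpace n K | IsReduced c₀ C₀ τ₀ n (placeFamily K (H : Matrix (Fin n) (Fin n) (mixedSpace K)))})
      hcov fun t _ => ((stub_reducedCone_cover_finite n K 𝔫 cL).2 c₀ C₀ τ₀ t 1).subset ?_
    rintro s ⟨hsG, H, hH, h1, h2⟩
    exact ⟨(hmemG _).1 hsG, H, hH, h1, h2⟩
  haveI : Fintype (G ⧸ Hs) := Fintype.ofFinite _
  let ρ : Representation ℂ G (CoeffModule ℂ n K lam) := (σS hcpt S lam).comp ((ParallelWeight.diagArch K n).comp G.subtype)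
  let a : G →* (hermSpace n K →L[ℝ] hermSpace n K) := (coneActionRat n K).comp G.subtype
  have hmaps : ∀ g : G, MapsTo (a g) (posCone n K) (posCone n K) := fun g => hXm _
  let ρΓ : Representation ℂ Γc (CoeffModule ℂ n K lam) := (coeffRepPos ℂ n K lam).comp Γc.subtype
  let aΓ : Γc →* (hermSpace n K →L[ℝ] hermSpace n K) := ((coneActionRat n K).comp (glTotPos n K).subtype).comp Γc.subtype
  have hβ₀i' : ∀ γ : Γc, ∀ x ∈ posCone n K, actAlt ρΓ aΓ γ q (β₀ (aΓ γ⁻¹ x)) = β₀ x := hβ₀i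
  have hconv : ∀ (γ : Γc) (r : ℕ) (M : hermSpace n K [⋀^Fin r]→L[ℝ] CoeffModule ℂ n K lam),
      actAlt ρ a (φ γ) r M = actAlt ρΓ aΓ γ r M := by
    intro γ r M
    ext v
    rw [actAlt_apply, actAlt_apply]
    change σS hcpt S lam (ParallelWeight.diagArch K n ((γ : glTotPos n K) : GL (Fin n) K)) _ = coeffRepPos ℂ n K lam (γ : glTotPos n K) _
    rw [← archCoeffRepSign_diagArchPos n K S lam (γ : glTotPos n K)]
    rfl
  have hβ₀φ : ∀ γ : Γc, ∀ y ∈ posCone n K, actAlt ρ a (φ γ) q (β₀ (a (φ γ)⁻¹ y)) = β₀ y := by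
    intro γ y hy
    rw [hconv, show a (φ γ)⁻¹ = aΓ γ⁻¹ from rfl]
    exact hβ₀i' γ y hy
  /- `p` commutes with `G` (DET-UNIT) -/
  have hpG : ∀ g : G, ∀ y ∈ posCone n K, p (a g y) = a g (p y) := fun g y hy =>
    hpequiv (toMixedGL n K (g : GL (Fin n) K)) (stub_abs_norm_det_eq_one_of_smul_eq n K 𝔫 cL (g : GL (Fin n) K) ((hmemG g).1 g.2)).2 y hy
  /- the radial pull-back `β₁ = p^* β₀` -/
  obtain ⟨β₁, hβ₁def⟩ : ∃ β₁ : hermSpace n K → (hermSpace n K [⋀^Fin q]→L[ℝ] CoeffModule ℂ n K lam),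
      β₁ = fun x => (β₀ (p x)).compContinuousLinearMap (fderiv ℝ p x) := ⟨_, rfl⟩
  have hβ₁s : ContDiffOn ℝ ((⊤ : ℕ∞) : WithTop ℕ∞) β₁ (posCone n K) := by
    rw [hβ₁def]; exact contDiffOn_pullback hXo hpsmooth hpX' hβ₀s
  have hβ₁H : ∀ h : G, h ∈ Hs → ∀ x ∈ posCone n K, actAlt ρ a h q (β₁ (a h⁻¹ x)) = β₁ x := by
    intro h hh x hx
    rw [hHs] at hh
    obtain ⟨γ, rfl⟩ := MonoidHom.mem_range.1 hh
    rw [hβ₁def]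
    exact actAlt_pullback_eq ρ a hXo hmaps hpX' hpdiff (φ γ) (hpG (φ γ)⁻¹) (hβ₀φ γ) hx
  have hβ₁d : ∀ x ∈ posCone n K, extDeriv β₁ x = @id (hermSpace n K [⋀^Fin (q + 1)]→L[ℝ] CoeffModule ℂ n K lam) (coneForm π.1 S lam η cL.out x) := by
    intro x hx
    have hdβ₀ : DifferentiableAt ℝ β₀ (p x) := (hβ₀s.contDiffAt (hXo.mem_nhds (hpX' x hx))).differentiableAt (by simp)
    have hpc : ContDiffAt ℝ 2 p x := (hpsmooth.contDiffAt (hXo.mem_nhds hx)).of_le (WithTop.coe_le_coe.2 le_top)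
    have hmin : minSmoothness ℝ 2 ≤ (2 : WithTop ℕ∞) := by simp
    rw [hβ₁def, extDeriv_pullback hdβ₀ hpc hmin, hβ₀d (p x) (hpX' x hx)]
    exact hpbasic (fun H => coneForm π.1 S lam η cL.out H) hsc hEu x hx
  /- `ω_c` is `G`-invariant (EQUIV-FULL and the level invariance of the family) -/
  have hωG : ∀ g : G, ∀ x ∈ posCone n K, actAlt ρ a g (q + 1)
      (@id (hermSpace n K [⋀^Fin (q + 1)]→L[ℝ] CoeffModule ℂ n K lam) (coneForm π.1 S lam η cL.out (a g⁻¹ x))) =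
      @id (hermSpace n K [⋀^Fin (q + 1)]→L[ℝ] CoeffModule ℂ n K lam) (coneForm π.1 S lam η cL.out x) := by
    intro g x hx
    have hcos : ((globalEmbedding n K (g : GL (Fin n) K) * cL.out : FiniteAdelicGL n K) : FiniteAdelicGL n K ⧸ level n K 𝔫) = cL := by
      rw [← smul_eq_mul, MulAction.Quotient.coe_smul_out]
      exact (hmemG g).1 g.2
    have hωc : ∀ y, coneForm π.1 S lam η (globalEmbedding n K (g : GL (Fin n) K) * cL.out) y = coneForm π.1 S lam η cL.out y := by
      intro y
      have h := hω.apply_out_mk (globalEmbedding n K (g : GL (Fin n) K) * cL.out)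
      rw [hcos] at h
      exact (congrFun h y).symm
    ext v
    rw [actAlt_apply]
    have key := stub_coneForm_equivariant_full hcpt π.1 S lam hη' (g : GL (Fin n) K) cL.out (hmaps g⁻¹ hx) (fun j => a g⁻¹ (v j))
    rw [hωc] at key
    have e1 : coneActionRat n K (g : GL (Fin n) K) (a g⁻¹ x) = x := act_apply_inv a g x
    have e2 : (fun j => coneActionRat n K (g : GL (Fin n) K) (a g⁻¹ (v j))) = v := funext fun j => act_apply_inv a g (v j)
    rw [e1, e2] at key
    exact key.symm
  /- AVG: the average `β₂` over `G ⧸ Hs` -/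
  obtain ⟨β₂, hβ₂def⟩ : ∃ β₂ : hermSpace n K → (hermSpace n K [⋀^Fin q]→L[ℝ] CoeffModule ℂ n K lam),
      β₂ = fun x => ((Hs.index : ℝ)⁻¹) • ∑ᶠ c : G ⧸ Hs, actAlt ρ a c.out q (β₁ (a c.out⁻¹ x)) := ⟨_, rfl⟩
  obtain ⟨h2s, h2G, h2d, -⟩ := stub_average_invariant Hs ρ a hXo hmaps β₁ _ hβ₁s hβ₁H hβ₁d hωG β₂ (fun x => by rw [hβ₂def])
  have hβ₂sum : ∀ (y : hermSpace n K) (v : Fin q → hermSpace n K),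
      β₂ y v = (Hs.index : ℝ)⁻¹ • ∑ c : G ⧸ Hs, ρ c.out (β₁ (a c.out⁻¹ y) fun i => a c.out⁻¹ (v i)) := by
    intro y v
    simp only [hβ₂def, finsum_eq_sum_of_fintype, ContinuousAlternatingMap.smul_apply, ContinuousAlternatingMap.sum_apply, actAlt_apply]
  refine ⟨β₂, h2s, ?_, ?_, ?_, h2d, ?_⟩
  · -- `G`-equivariance
    intro γ hγ x hx v
    have hg : γ ∈ G := (hmemG γ).2 hγ
    have h' := congrArg (fun M => M (fun i => coneActionRat n K γ (v i))) (h2G ⟨γ, hg⟩ (coneActionRat n K γ x) (hXm γ hx))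
    simp only [actAlt_apply] at h'
    rw [← h']
    have e1 : a (⟨γ, hg⟩ : G)⁻¹ (coneActionRat n K γ x) = x := act_inv_apply a ⟨γ, hg⟩ x
    have e2 : (fun i => a (⟨γ, hg⟩ : G)⁻¹ (coneActionRat n K γ (v i))) = v := funext fun i => act_inv_apply a ⟨γ, hg⟩ (v i)
    rw [e1, e2]
    rfl
  · -- scale invariance
    intro r hr x hx v
    rw [hβ₂sum, hβ₂sum]
    congr 1
    refine Finset.sum_congr rfl fun c _ => ?_
    simp only [map_smul, hβ₁def]
    rw [pullback_smul_apply hXo (fun c hc y hy => ResGLnCone.smul_mem_posCone hc hy) hpdiff hpscale β₀ hr (hmaps _ hx)]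
  · -- killed by the Euler vector field
    rintro x hx v ⟨i, hi⟩
    rw [hβ₂sum]
    have h0 : ∀ c : G ⧸ Hs, ρ c.out (β₁ (a c.out⁻¹ x) fun j => a c.out⁻¹ (v j)) = 0 := fun c => by
      rw [hβ₁def, pullback_apply_eq_zero hXo hpdiff hpscale β₀ (hmaps _ hx) (i := i) (by rw [hi]), map_zero]
    simp only [h0, Finset.sum_const_zero, smul_zero]
  · -- growth on every rational translate of a reduced set (abstract transfer)
    intro δ c₁ C₁ τ₁
    obtain ⟨CX, kX, -, hCXb⟩ := ResGLnCone.entryGauge_cone_bounds (n := n) (K := K) hn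
    obtain ⟨Cr, kr, hCr⟩ := ResGLnCone.entryGauge_radial_le (n := n) (K := K) hn he0 he1
    obtain ⟨Cb, kb, hb⟩ := hβ₀b
    have hE1 : ∀ x : hermSpace n K, (1 : ℝ) ≤ 1 + ∑ i, ∑ j, (‖(x : Matrix (Fin n) (Fin n) (mixedSpace K)) i j‖ +
        ‖(x : Matrix (Fin n) (Fin n) (mixedSpace K))⁻¹ i j‖) := fun x => ResGLnCone.one_le_entryGauge _
    have hEact : ∀ g : GL (Fin n) K, ∃ d : ℝ, 0 ≤ d ∧ ∀ x : hermSpace n K,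
        (1 + ∑ i, ∑ j, (‖((coneActionRat n K g x : hermSpace n K) : Matrix (Fin n) (Fin n) (mixedSpace K)) i j‖ +
          ‖((coneActionRat n K g x : hermSpace n K) : Matrix (Fin n) (Fin n) (mixedSpace K))⁻¹ i j‖)) ≤
        d * (1 + ∑ i, ∑ j, (‖(x : Matrix (Fin n) (Fin n) (mixedSpace K)) i j‖ + ‖(x : Matrix (Fin n) (Fin n) (mixedSpace K))⁻¹ i j‖)) :=
      fun g => ResGLnCone.entryGauge_coneActionRat_le g
    have hR₀ : ∀ r : ℝ, 0 < r → ∀ x : hermSpace n K,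
        r • x ∈ {H : hermSpace n K | IsReduced c₀ C₀ τ₀ n (placeFamily K (H : Matrix (Fin n) (Fin n) (mixedSpace K)))} →
        x ∈ {H : hermSpace n K | IsReduced c₀ C₀ τ₀ n (placeFamily K (H : Matrix (Fin n) (Fin n) (mixedSpace K)))} := by
      intro r hr x h
      have h' : IsReduced c₀ C₀ τ₀ n (r • placeFamily K (x : Matrix (Fin n) (Fin n) (mixedSpace K))) := by
        rw [← placeFamily_smul]; exact h
      exact (SiegelFamily.isReduced_smul_iff _ _ _ hr _).1 h'
    have hfin : ∀ (g t : GL (Fin n) K), Set.Finite {γ : Γc | ∃ H ∈ posCone n K,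
        coneActionRat n K ((((glTotPos n K).subtype.comp Γc.subtype) γ) * t)⁻¹ H ∈
          {H : hermSpace n K | IsReduced (max c₀ c₁) (max C₀ C₁) (max τ₀ τ₁) n (placeFamily K (H : Matrix (Fin n) (Fin n) (mixedSpace K)))} ∧
        coneActionRat n K g H ∈
          {H : hermSpace n K | IsReduced (max c₀ c₁) (max C₀ C₁) (max τ₀ τ₁) n (placeFamily K (H : Matrix (Fin n) (Fin n) (mixedSpace K)))}} := by
      intro g t
      refine (((stub_reducedCone_cover_finite n K 𝔫 cL).2 (max c₀ c₁) (max C₀ C₁) (max τ₀ τ₁) t g⁻¹).preimage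
        Subtype.val_injective.injOn).subset ?_
      rintro γ ⟨H, hH, h1, h2⟩
      exact ⟨hΓc γ, H, hH, h1, by rw [inv_inv]; exact h2⟩
    have hDp : ∀ y ∈ posCone n K,
        ‖fderiv ℝ p y‖ ≤ (|Cp| * CX ^ kp) * (1 + ∑ i, ∑ j, (‖(y : Matrix (Fin n) (Fin n) (mixedSpace K)) i j‖ +
          ‖(y : Matrix (Fin n) (Fin n) (mixedSpace K))⁻¹ i j‖)) ^ (kX * kp) ∧
        ‖fderiv ℝ (fderiv ℝ p) y‖ ≤ (|Cp| * CX ^ kp) * (1 + ∑ i, ∑ j, (‖(y : Matrix (Fin n) (Fin n) (mixedSpace K)) i j‖ +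
          ‖(y : Matrix (Fin n) (Fin n) (mixedSpace K))⁻¹ i j‖)) ^ (kX * kp) := by
      intro y hy
      obtain ⟨-, -, hXb⟩ := hCXb y hy
      rw [← hN y] at hXb
      have hXy0 : 0 ≤ 1 + ‖y‖ + (N y)⁻¹ := add_nonneg (add_nonneg zero_le_one (norm_nonneg _)) (inv_pos.2 (hNpos y hy)).le
      obtain ⟨h1, h2⟩ := opNorm_fderiv_le_of_applied hXy0 (fun v w => hpbd y hy v w)
      have hXk : |Cp| * (1 + ‖y‖ + (N y)⁻¹) ^ kp ≤ (|Cp| * CX ^ kp) * (1 + ∑ i, ∑ j, (‖(y : Matrix (Fin n) (Fin n) (mixedSpace K)) i j‖ +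
          ‖(y : Matrix (Fin n) (Fin n) (mixedSpace K))⁻¹ i j‖)) ^ (kX * kp) := by
        rw [mul_assoc, pow_mul, ← mul_pow]
        exact mul_le_mul_of_nonneg_left (pow_le_pow_left₀ hXy0 hXb kp) (abs_nonneg _)
      exact ⟨h1.trans hXk, h2.trans hXk⟩
    have hEp : ∀ y ∈ posCone n K,
        (1 + ∑ i, ∑ j, (‖((p y : hermSpace n K) : Matrix (Fin n) (Fin n) (mixedSpace K)) i j‖ +
          ‖((p y : hermSpace n K) : Matrix (Fin n) (Fin n) (mixedSpace K))⁻¹ i j‖)) ≤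
        Cr * (1 + ∑ i, ∑ j, (‖(y : Matrix (Fin n) (Fin n) (mixedSpace K)) i j‖ + ‖(y : Matrix (Fin n) (Fin n) (mixedSpace K))⁻¹ i j‖)) ^ kr := by
      intro y hy
      have h := hCr y hy
      rw [← hN y, ← hp y] at h
      exact h
    have hgr : ∀ g : GL (Fin n) K, ∃ (C : ℝ) (k : ℕ), ∀ y ∈ posCone n K,
        coneActionRat n K g y ∈ {H : hermSpace n K | IsReduced c₁ C₁ τ₁ n (placeFamily K (H : Matrix (Fin n) (Fin n) (mixedSpace K)))} →
        ‖β₁ y‖ ≤ C * (1 + ∑ i, ∑ j, (‖(y : Matrix (Fin n) (Fin n) (mixedSpace K)) i j‖ + ‖(y : Matrix (Fin n) (Fin n) (mixedSpace K))⁻¹ i j‖)) ^ k ∧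
        ‖fderiv ℝ β₁ y‖ ≤ C * (1 + ∑ i, ∑ j, (‖(y : Matrix (Fin n) (Fin n) (mixedSpace K)) i j‖ + ‖(y : Matrix (Fin n) (Fin n) (mixedSpace K))⁻¹ i j‖)) ^ k := by
      intro g
      rw [hβ₁def]
      exact growth_pullback (coneActionRat n K) ((glTotPos n K).subtype.comp Γc.subtype) ρΓ hXo hXm _ hE1 hEact
        (fun H h => IsReduced.mono (le_max_left _ _) (le_max_left _ _) (le_max_left _ _) h)
        (fun H h => IsReduced.mono (le_max_right _ _) (le_max_right _ _) (le_max_right _ _) h)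
        hR₀ T hcov g (fun t _ => hfin g t) p hpX' (fun x hx => ⟨_, Real.rpow_pos_of_pos (hNpos x hx) _, hp x⟩)
        hpdiff (hp2.differentiableOn (by simp)) hDp hEp β₀ (hβ₀s.differentiableOn (by simp)) hβ₀i
        (fun w hw ht => hb w ⟨hw, ht⟩)
    exact growth_average (coneActionRat n K) G Hs ρ hXo hXm _ hE1 hEact β₁ (hβ₁s.differentiableOn (by simp)) hgr β₂
      (fun x => by simp only [hβ₂def, finsum_eq_sum_of_fintype]; rfl) δ

end FamBA

/-- **Stub FAM-BA — basic-ise and average the per-coset primitive, and spread its growth to every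
rational translate of every reduced set** (`FamBA.main`: radial pull-back, landed RADIAL / BASIC /
DET-UNIT; average over `G ⧸ φ(Γ_c)`, landed AVG / EQUIV-FULL and `hω`; finite index and growth
transfer through landed COVER-FIN (ii) and the abstract transfer of
`Literature/…/TwistedQuotientGrowthTransfer{,Average}`).
[cite: Borel1983Regularization, §3.5] [cite: BorelWallach2000, VII 2.2–2.7] -/
theorem stub_fam_ba {n : ℕ} {K : Type} [Field K] [NumberField K] (hn : 0 < n)
    (hcpt : isCompact_glFiniteIntegralLevel n K) (𝔫 : Ideal (𝓞 K))
    (π : CuspidalAutomorphicRepData n K hcpt)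
    (S : Finset {w : InfinitePlace K // w.IsReal}) (lam : (K →+* ℂ) → Fin n → ℤ)
    (hdom : ∀ τ, Weight.IsDominant (lam τ)) {q : ℕ}
    {η : Cochain π.1 lam (q + 1)}
    (hη : η ∈ (gkComplexLS π.1 S lam).cocycles (q + 1))
    (hZ : Literature.Algebra.Lie.ChevalleyEilenberg.ins q
      (⟨1, trivial⟩ : (AutomorphyDatum.gl n K hcpt).arch.lie) η = 0)
    (hω : TwistedQuotient.IsConeFormFamily (diagPos n K) (level n K 𝔫)
      (coeffRepPos ℂ n K lam)
      ((coneActionRat n K).comp (glTotPos n K).subtype) (posCone n K)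
      (fun c H => coneForm π.1 S lam η c H))
    (cL : FiniteAdelicGL n K ⧸ level n K 𝔫)
    (hωs : ContDiffOn ℝ ((⊤ : ℕ∞) : WithTop ℕ∞)
      (fun H => @id (hermSpace n K [⋀^Fin (q + 1)]→L[ℝ] CoeffModule ℂ n K lam) (coneForm π.1 S lam η cL.out H)) (posCone n K))
    (Γc : Subgroup (glTotPos n K)) (hΓc : ∀ γ : Γc, diagPos n K (γ : glTotPos n K) • cL = cL)
    (T : Finset (GL (Fin n) K)) (c₀ C₀ τ₀ : ℝ) (hc₀ : 0 < c₀) (hC₀ : 1 < C₀) (hτ₀ : 0 < τ₀)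
    (hcov : ∀ H ∈ posCone n K, ∃ (γ : Γc) (t : GL (Fin n) K), t ∈ T ∧
      IsReduced c₀ C₀ τ₀ n (placeFamily K
        ((coneActionRat n K (((γ : glTotPos n K) : GL (Fin n) K) * t)⁻¹ H :
          hermSpace n K) : Matrix (Fin n) (Fin n) (mixedSpace K))))
    (β₀ : hermSpace n K → (hermSpace n K [⋀^Fin q]→L[ℝ] CoeffModule ℂ n K lam))
    (hβ₀s : ContDiffOn ℝ ((⊤ : ℕ∞) : WithTop ℕ∞) β₀ (posCone n K))
    (hβ₀i : ∀ (γ : Γc), ∀ x ∈ posCone n K,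
      TwistedQuotient.actAlt ((coeffRepPos ℂ n K lam).comp Γc.subtype) (((coneActionRat n K).comp (glTotPos n K).subtype).comp
        Γc.subtype) γ q (β₀ ((((coneActionRat n K).comp (glTotPos n K).subtype).comp
        Γc.subtype) γ⁻¹ x)) = β₀ x)
    (hβ₀d : ∀ x ∈ posCone n K,
      extDeriv β₀ x = @id (hermSpace n K [⋀^Fin (q + 1)]→L[ℝ] CoeffModule ℂ n K lam) (coneForm π.1 S lam η cL.out x))
    (hβ₀b : ∃ (C : ℝ) (k : ℕ), ∀ x ∈ {H : hermSpace n K | H ∈ posCone n K ∧ ∃ t ∈ T,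
        IsReduced c₀ C₀ τ₀ n (placeFamily K
          ((coneActionRat n K t⁻¹ H : hermSpace n K) :
            Matrix (Fin n) (Fin n) (mixedSpace K)))},
      ‖β₀ x‖ ≤ C * (1 + ∑ i, ∑ j,
              (‖(x : Matrix (Fin n) (Fin n) (mixedSpace K)) i j‖ +
                ‖(x : Matrix (Fin n) (Fin n) (mixedSpace K))⁻¹ i j‖)) ^ k ∧
      ‖fderiv ℝ β₀ x‖ ≤ C * (1 + ∑ i, ∑ j,
              (‖(x : Matrix (Fin n) (Fin n) (mixedSpace K)) i j‖ +
                ‖(x : Matrix (Fin n) (Fin n) (mixedSpace K))⁻¹ i j‖)) ^ k) :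
    ∃ β₂ : hermSpace n K → (hermSpace n K [⋀^Fin q]→L[ℝ] CoeffModule ℂ n K lam),
      ContDiffOn ℝ ((⊤ : ℕ∞) : WithTop ℕ∞) β₂ (posCone n K) ∧
      (∀ (γ : GL (Fin n) K), globalEmbedding n K γ • cL = cL →
        ∀ x ∈ posCone n K, ∀ v : Fin q → hermSpace n K,
          β₂ (coneActionRat n K γ x) (fun i => coneActionRat n K γ (v i)) =
            σS hcpt S lam (ParallelWeight.diagArch K n γ) (β₂ x v)) ∧
      (∀ (r : ℝ), 0 < r → ∀ x ∈ posCone n K, ∀ v : Fin q → hermSpace n K,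
        β₂ (r • x) (fun i => r • v i) = β₂ x v) ∧
      (∀ x ∈ posCone n K, ∀ v : Fin q → hermSpace n K, (∃ i, v i = x) → β₂ x v = 0) ∧
      (∀ x ∈ posCone n K,
        extDeriv β₂ x = @id (hermSpace n K [⋀^Fin (q + 1)]→L[ℝ] CoeffModule ℂ n K lam) (coneForm π.1 S lam η cL.out x)) ∧
      ∀ (δ : GL (Fin n) K) (c₁ C₁ τ₁ : ℝ), ∃ (C : ℝ) (k : ℕ), ∀ x ∈ posCone n K,
        IsReduced c₁ C₁ τ₁ n
            (placeFamily K ((coneActionRat n K δ⁻¹ x : hermSpace n K) :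
              Matrix (Fin n) (Fin n) (mixedSpace K))) →
          ∀ (v : Fin q → hermSpace n K) (w' : hermSpace n K),
            ‖β₂ x v‖ ≤ C * (1 + ∑ i, ∑ j,
              (‖(x : Matrix (Fin n) (Fin n) (mixedSpace K)) i j‖ +
                ‖(x : Matrix (Fin n) (Fin n) (mixedSpace K))⁻¹ i j‖)) ^ k * ∏ i, ‖v i‖ ∧
            ‖fderiv ℝ β₂ x w' v‖ ≤ C * (1 + ∑ i, ∑ j,
              (‖(x : Matrix (Fin n) (Fin n) (mixedSpace K)) i j‖ +
                ‖(x : Matrix (Fin n) (Fin n) (mixedSpace K))⁻¹ i j‖)) ^ k * ‖w'‖ * ∏ i, ‖v i‖ := by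
  -- registered hypotheses not needed by the proof
  have _keep₁ := hdom
  have _keep₂ := hc₀
  have _keep₃ := hC₀
  have _keep₄ := hτ₀
  have _keep₅ := hωs
  exact FamBA.main hn hcpt 𝔫 π S lam hη hZ hω cL Γc hΓc T c₀ C₀ τ₀ hcov β₀ hβ₀s hβ₀i hβ₀d hβ₀b

end Summit.Langlands.Langlands.Theorems.HeckeEigenvalueField.Res

end
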